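import Literature.MathematicalPhysics.QuantumFieldTheory.Balaban1983to89.B6Prop25GDivDecayTwoScaleV1
import Literature.MathematicalPhysics.QuantumFieldTheory.Balaban1983to89.B6Prop25GradDecayTwoScaleV1
import Literature.MathematicalPhysics.QuantumFieldTheory.Balaban1983to89.B6Prop25L2LocTwoScaleV1

/-!
# `Balaban1983to89.B6Prop25L2LocGradTwoScaleV1` — T. Bałaban, *Propagators and renormalization transformations for lattice gauge theories. II*,
# Commun. Math. Phys. **96** (1984) 223–250 [Balaban1984PropagatorsII], PROPOSITION 2.5 p. 246, THE MEMBERS `‖ζ∇GJ‖`, `‖ζG∇*J‖` OF (1.114) FOR THE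
# GENUINE TWO-SCALE `G = Δ_a⁻¹` OF (2.90), `Λ′ ⊂ T^{(j+1)}` ARBITRARY, for `tsV1` at the paper's scaling — file 15 of the two-level decay programme

statement-level skeleton of published theorems with citation tags; proofs where landed; nothing here is a claim about the Yang–Mills mass gap

p. 246 (Proposition 2.5, verbatim): *"The operator G_□ defined by (2.90) … has the representation (2.129) and satisfies all the inequalities
(1.110)–(1.114) of the Proposition 1.2 with a positive constant δ₂ instead of δ₀."*  [4] p. 36 (verbatim): *"Finally there exists a constant O(1)
such that ‖ζGJ‖, ‖ζ∇GJ‖, ‖ζG∇*J‖, ‖ζ∇G∇*J‖, ‖ζ∇∇GJ‖, ‖ζG∇*∇*J‖ ≤ O(1)e^{−δ₀|y−y′|}|ζ|‖J‖ (1.114) for supp ζ ⊂ Δ̃(y), supp J ⊂ Δ̃(y′)."*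

WHAT THIS FILE DOES.  File 11's BLOCK SCHUR TEST (`…B6Prop25L2LocTwoScaleV1.sum_sq_apply_le_of_blockBounds`: a row block bound of `f` and a row block
bound of `f*` give localized `ℓ²` decay) applied to `f = ∇_λG` and `f = G∇_λ*` for the two-scale `G` of `tsV1`: §1 the adjoints `(∇_λG)* = G∇_λ*`,
`(G∇_λ*)* = ∇_λG` (`G* = G` file 11's `adjoint_G_V1`, `∇_λ*` = the adjoint of `∇_λ` file 12's `adjoint_Dop`), so that the row block bounds of file 10
(`blockBound_DG_scaling`) and file 14 (`blockBound_GDadj_scaling`) are each other's column block bounds; §2 **`prop25_ineq114_grad`** (`‖ζ∇_λGJ‖`) and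
§3 **`prop25_ineq114_Gdiv`** (`‖ζG∇_λ*J‖`), with their square-root forms.

HONEST SCOPE / DIVERGENCES. (1) With files 7, 10, 11, 14 the members `|GJ|`, `|∇GJ|`, `|G∇*J|` of (1.110) and `‖ζGJ‖`, `‖ζ∇GJ‖`, `‖ζG∇*J‖` of
(1.114) are theorems for the genuine two-scale `G`; `ΔGJ`, the three members of (1.114) with two derivatives and (1.111)–(1.113) are not treated.
(2) `‖·‖` = the Euclidean norm on fine bond fields on both sides; `(ζA)(b₀) = ζ(b₀₋)A(b₀)`; cubes replaced by unions of blocks within `r`, as in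
files 7, 10, 11, 14. (3) `c = L^j`; weights in [4]'s window; `C, δ₂` depend on `d, L, a₀, a₁` only. (4) No new definition, no new hypothesis.  NOT
summit progress.  Unit `lit-balaban-p22` (gen 15), 2026-08-22.
-/

noncomputable section

open scoped InnerProductSpace BigOperators
open Finset

namespace Literature.MathematicalPhysics.QuantumFieldTheory.Balaban1983to89.B6Prop25L2LocGradTwoScaleV1

open LatticeFieldCalculus B5SectBStatements B5Eq117TorusCarriers B6SectADomainsV1 B6SectAOperatorsV1 B6SectAVectorModelV1 B6SectCOperators
  B6SectCTwoScaleV1 B6SectCTwoScaleV1Lattice B5Eq118OneStroke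
open BalabanImbrieJaffe1984to88.BIJ85AxialPropagator411 (BondSpace)
open B4Sect5Torus (IsPseudoDist SumBound)
open B4TorusKernel.MultiPeriod (torusSupNorm torusSupNorm_nonneg)
open B4Sect5Proof (latticeConst latticeConst_nonneg)
open B6LowerBound2153Torus (rep)
open B5WalkCarrierTorus (normSq_eq)
open B6BlockDecayCalculus (blockBound_mono torusDist_isPseudoDist torusDist_sumBound)
open B6BlockDecayGradFactorsV1 (Dop_comp_apply)
open B6Prop25GradDecayTwoScaleV1 (blockBound_DG_scaling)
open B6Prop25L2LocTwoScaleV1 (sum_sq_apply_le_of_blockBounds adjoint_G_V1)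
open B6BlockDecayGDivBridgeV1 (adjoint_Dop)
open B6Prop25GDivDecayTwoScaleV1 (blockBound_GDadj_scaling)

variable {d L m K : ℕ} {hd : 1 ≤ d + 1} {hL : Odd L ∧ 1 < L} {j : ℕ}

/-! ## §1  `‖ζ∇GJ‖`: the member of (1.114) with the gradient on the left -/

open Classical in
/-- **PROPOSITION 2.5, THE MEMBER `‖ζ∇GJ‖` OF (1.114)** for the genuine two-scale `G` of (2.90), `Λ′` arbitrary (at `c = L^j`, weights
`a₀n^{d+1} ≤ w ≤ a₁n^{d+1}`), component `λ`: there are `δ₂ > 0`, `C ≥ 0` depending on `d, L, a₀, a₁` only such that for every volume, `j + 1 ≤ m + K`, `Λ′`,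
weights in the window, direction `λ`, radius `r ≥ 0`, every fine bond field `J` supported on the fine bonds over the unit sites within `r` of `y′`, and
every real fine-lattice function `ζ` supported over the unit sites within `r` of `y` with `|ζ| ≤ Z`:
`Σ_{b₀} (ζ(b₀₋)·n((GJ)(b₀ + e_λ) − (GJ)(b₀)))² ≤ (C·e^{(1+2δ₂)r}·e^{−δ₂|y − y′|_T}·Z)²·‖J‖²` — file 11's block Schur test with the row block bound of
`∇_λG` (file 10) and its column block bound = the row block bound of `(∇_λG)* = G∇_λ*` (file 14; `G* = G`, `∇_λ** = ∇_λ`).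
[cite: Balaban1984PropagatorsII, Prop. 2.5 p.246; Balaban1984PropagatorsI, (1.114) p.36] -/
theorem prop25_ineq114_grad (d L : ℕ) (hd : 1 ≤ d + 1) (hL : Odd L ∧ 1 < L) {a₀ a₁ : ℝ} (ha₀ : 0 < a₀) (ha₁ : a₀ ≤ a₁) :
    ∃ δ : ℝ, 0 < δ ∧ ∃ C : ℝ, 0 ≤ C ∧ ∀ (m K : ℕ) (j : ℕ) (hc : ((L : ℝ) ^ j) ≠ 0)
      (_hj : j + 1 ≤ (⟨d + 1, L, m, K, hd, hL⟩ : Params).m + (⟨d + 1, L, m, K, hd, hL⟩ : Params).K)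
      (Λ' : Finset (Site (⟨d + 1, L, m, K, hd, hL⟩ : Params) (j + 1))) (w : CIdx j Λ' → ℝ)
      (_hw0 : ∀ i, a₀ * ((L : ℝ) ^ j) ^ (d + 1) ≤ w i) (_hw1 : ∀ i, w i ≤ a₁ * ((L : ℝ) ^ j) ^ (d + 1)) (lam : Fin (d + 1))
      (r : ℝ) (_hr : 0 ≤ r) (J : BondSpace (⟨d + 1, L, m, K, hd, hL⟩ : Params))
      (ζ : Site (⟨d + 1, L, m, K, hd, hL⟩ : Params) 0 → ℝ) (Z : ℝ) (_hZ : 0 ≤ Z)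
      (y y' : Site (⟨d + 1, L, m, K, hd, hL⟩ : Params) j)
      (_hsuppJ : ∀ b : PBond (⟨d + 1, L, m, K, hd, hL⟩ : Params) 0, J b ≠ 0 →
        torusSupNorm (Mk (⟨d + 1, L, m, K, hd, hL⟩ : Params) j) (rep (Mk (⟨d + 1, L, m, K, hd, hL⟩ : Params) j) (iterBlockOf j b.src) - rep (Mk (⟨d + 1, L, m, K, hd, hL⟩ : Params) j) y') ≤ r)
      (_hsuppζ : ∀ x : Site (⟨d + 1, L, m, K, hd, hL⟩ : Params) 0, ζ x ≠ 0 →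
        torusSupNorm (Mk (⟨d + 1, L, m, K, hd, hL⟩ : Params) j) (rep (Mk (⟨d + 1, L, m, K, hd, hL⟩ : Params) j) (iterBlockOf j x) - rep (Mk (⟨d + 1, L, m, K, hd, hL⟩ : Params) j) y) ≤ r)
      (_hζ : ∀ x : Site (⟨d + 1, L, m, K, hd, hL⟩ : Params) 0, |ζ x| ≤ Z),
      ∑ b₀ : PBond (⟨d + 1, L, m, K, hd, hL⟩ : Params) 0, (ζ b₀.src * (((L : ℝ) ^ j) * ((tsV1 hc Λ' w).G J ⟨b₀.src.shift lam, b₀.dir⟩ - (tsV1 hc Λ' w).G J b₀))) ^ 2 ≤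
        (C * Real.exp ((1 + 2 * δ) * r) * Real.exp (-(δ * torusSupNorm (Mk (⟨d + 1, L, m, K, hd, hL⟩ : Params) j)
          (rep (Mk (⟨d + 1, L, m, K, hd, hL⟩ : Params) j) y - rep (Mk (⟨d + 1, L, m, K, hd, hL⟩ : Params) j) y'))) * Z) ^ 2 * ‖J‖ ^ 2 := by
  obtain ⟨δa, hδa, Ca, hCa, hrow⟩ := blockBound_DG_scaling d L hd hL ha₀ ha₁
  obtain ⟨δb, hδb, Cb, hCb, hcol⟩ := blockBound_GDadj_scaling d L hd hL ha₀ ha₁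
  have hδ0 : 0 < min δa δb := lt_min hδa hδb
  have hC : 0 ≤ max Ca Cb := le_max_of_le_left hCa
  refine ⟨min δa δb, hδ0, max Ca Cb * latticeConst (d + 1) 1, mul_nonneg hC (latticeConst_nonneg _ zero_le_one), ?_⟩
  intro m K j hc hj Λ' w hw0 hw1 lam r hr J ζ Z hZ y y' hsuppJ hsuppζ hζ
  have hL0 : 0 < L := by have := hL.2; omega
  have hLp : (0 : ℝ) < L := by exact_mod_cast hL0
  have hw : ∀ i, 0 < w i := fun i => lt_of_lt_of_le (by positivity) (hw0 i)
  have hρ : IsPseudoDist (fun t t' : Site (⟨d + 1, L, m, K, hd, hL⟩ : Params) j => torusSupNorm (Mk (⟨d + 1, L, m, K, hd, hL⟩ : Params) j) (rep (Mk (⟨d + 1, L, m, K, hd, hL⟩ : Params) j) t - rep (Mk (⟨d + 1, L, m, K, hd, hL⟩ : Params) j) t')) :=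
    torusDist_isPseudoDist (Mk (⟨d + 1, L, m, K, hd, hL⟩ : Params) j)
  have hK : SumBound (fun t t' : Site (⟨d + 1, L, m, K, hd, hL⟩ : Params) j => torusSupNorm (Mk (⟨d + 1, L, m, K, hd, hL⟩ : Params) j) (rep (Mk (⟨d + 1, L, m, K, hd, hL⟩ : Params) j) t - rep (Mk (⟨d + 1, L, m, K, hd, hL⟩ : Params) j) t')) (fun a => latticeConst (d + 1) a) :=
    torusDist_sumBound (Mk (⟨d + 1, L, m, K, hd, hL⟩ : Params) j)
  have hadj : LinearMap.adjoint (((((L : ℝ) ^ j) • (onE (LinearMap.funLeft ℝ ℝ (fun b : PBond (⟨d + 1, L, m, K, hd, hL⟩ : Params) 0 => (⟨b.src.shift lam, b.dir⟩ : PBond (⟨d + 1, L, m, K, hd, hL⟩ : Params) 0))) - LinearMap.id) : BondSpace (⟨d + 1, L, m, K, hd, hL⟩ : Params) →ₗ[ℝ] BondSpace (⟨d + 1, L, m, K, hd, hL⟩ : Params))) ∘ₗ (tsV1 hc Λ' w).G) = (tsV1 hc Λ' w).G ∘ₗ ((((L : ℝ) ^ j) • (onE (LinearMap.funLeft ℝ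 ℝ (fun b : PBond (⟨d + 1, L, m, K, hd, hL⟩ : Params) 0 => (⟨b.src.unshift lam, b.dir⟩ : PBond (⟨d + 1, L, m, K, hd, hL⟩ : Params) 0))) - LinearMap.id) : BondSpace (⟨d + 1, L, m, K, hd, hL⟩ : Params) →ₗ[ℝ] BondSpace (⟨d + 1, L, m, K, hd, hL⟩ : Params))) := by
    rw [LinearMap.adjoint_comp ((((L : ℝ) ^ j) • (onE (LinearMap.funLeft ℝ ℝ (fun b : PBond (⟨d + 1, L, m, K, hd, hL⟩ : Params) 0 => (⟨b.src.shift lam, b.dir⟩ : PBond (⟨d + 1, L, m, K, hd, hL⟩ : Params) 0))) - LinearMap.id) : BondSpace (⟨d + 1, L, m, K, hd, hL⟩ : Params) →ₗ[ℝ] BondSpace (⟨d + 1, L, m, K, hd, hL⟩ : Params))) (tsV1 hc Λ' w).G, adjoint_G_V1 hc hj Λ' hw, adjoint_Dop]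
  have hf := blockBound_mono hρ (((((L : ℝ) ^ j) • (onE (LinearMap.funLeft ℝ ℝ (fun b : PBond (⟨d + 1, L, m, K, hd, hL⟩ : Params) 0 => (⟨b.src.shift lam, b.dir⟩ : PBond (⟨d + 1, L, m, K, hd, hL⟩ : Params) 0))) - LinearMap.id) : BondSpace (⟨d + 1, L, m, K, hd, hL⟩ : Params) →ₗ[ℝ] BondSpace (⟨d + 1, L, m, K, hd, hL⟩ : Params))) ∘ₗ (tsV1 hc Λ' w).G) (fun b₀ : PBond (⟨d + 1, L, m, K, hd, hL⟩ : Params) 0 => iterBlockOf j b₀.src) (fun b₀ : PBond (⟨d + 1, L, m, K, hd, hL⟩ : Params) 0 => iterBlockOf j b₀.src) hC (le_max_left Ca Cb) (min_le_left δa δb) (hrow m K j hc hj Λ' w hw0 hw1 lam)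
  have hg : ∀ (k : PBond (⟨d + 1, L, m, K, hd, hL⟩ : Params) 0) (y : Site (⟨d + 1, L, m, K, hd, hL⟩ : Params) j),
      ∑ i ∈ univ.filter (fun i : PBond (⟨d + 1, L, m, K, hd, hL⟩ : Params) 0 => iterBlockOf j i.src = y),
          |LinearMap.adjoint (((((L : ℝ) ^ j) • (onE (LinearMap.funLeft ℝ ℝ (fun b : PBond (⟨d + 1, L, m, K, hd, hL⟩ : Params) 0 => (⟨b.src.shift lam, b.dir⟩ : PBond (⟨d + 1, L, m, K, hd, hL⟩ : Params) 0))) - LinearMap.id) : BondSpace (⟨d + 1, L, m, K, hd, hL⟩ : Params) →ₗ[ℝ] BondSpace (⟨d + 1, L, m, K, hd, hL⟩ : Params))) ∘ₗ (tsV1 hc Λ' w).G) (EuclideanSpace.single i (1 : ℝ)) k| ≤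
        max Ca Cb * Real.exp (-(min δa δb * torusSupNorm (Mk (⟨d + 1, L, m, K, hd, hL⟩ : Params) j) (rep (Mk (⟨d + 1, L, m, K, hd, hL⟩ : Params) j) (iterBlockOf j k.src) - rep (Mk (⟨d + 1, L, m, K, hd, hL⟩ : Params) j) y))) := by
    rw [hadj]
    exact blockBound_mono hρ _ (fun b₀ : PBond (⟨d + 1, L, m, K, hd, hL⟩ : Params) 0 => iterBlockOf j b₀.src) (fun b₀ : PBond (⟨d + 1, L, m, K, hd, hL⟩ : Params) 0 => iterBlockOf j b₀.src) hC (le_max_right Ca Cb) (min_le_right δa δb) (hcol m K j hc hj Λ' w hw0 hw1 lam)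
  have hS := sum_sq_apply_le_of_blockBounds hρ hK (((((L : ℝ) ^ j) • (onE (LinearMap.funLeft ℝ ℝ (fun b : PBond (⟨d + 1, L, m, K, hd, hL⟩ : Params) 0 => (⟨b.src.shift lam, b.dir⟩ : PBond (⟨d + 1, L, m, K, hd, hL⟩ : Params) 0))) - LinearMap.id) : BondSpace (⟨d + 1, L, m, K, hd, hL⟩ : Params) →ₗ[ℝ] BondSpace (⟨d + 1, L, m, K, hd, hL⟩ : Params))) ∘ₗ (tsV1 hc Λ' w).G) (fun b₀ : PBond (⟨d + 1, L, m, K, hd, hL⟩ : Params) 0 => iterBlockOf j b₀.src) (fun b₀ : PBond (⟨d + 1, L, m, K, hd, hL⟩ : Params) 0 => iterBlockOf j b₀.src) hC hC hδ0.le hf hg J y y' hsuppJ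
  -- `ζ` vanishes off the ball of `y` and is bounded by `Z` on it
  have hζ2 : ∀ b₀ : PBond (⟨d + 1, L, m, K, hd, hL⟩ : Params) 0, (ζ b₀.src * (((((L : ℝ) ^ j) • (onE (LinearMap.funLeft ℝ ℝ (fun b : PBond (⟨d + 1, L, m, K, hd, hL⟩ : Params) 0 => (⟨b.src.shift lam, b.dir⟩ : PBond (⟨d + 1, L, m, K, hd, hL⟩ : Params) 0))) - LinearMap.id) : BondSpace (⟨d + 1, L, m, K, hd, hL⟩ : Params) →ₗ[ℝ] BondSpace (⟨d + 1, L, m, K, hd, hL⟩ : Params))) ∘ₗ (tsV1 hc Λ' w).G) J b₀) ^ 2 ≤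
      (if torusSupNorm (Mk (⟨d + 1, L, m, K, hd, hL⟩ : Params) j) (rep (Mk (⟨d + 1, L, m, K, hd, hL⟩ : Params) j) (iterBlockOf j b₀.src) - rep (Mk (⟨d + 1, L, m, K, hd, hL⟩ : Params) j) y) ≤ r
        then Z ^ 2 * ((((((L : ℝ) ^ j) • (onE (LinearMap.funLeft ℝ ℝ (fun b : PBond (⟨d + 1, L, m, K, hd, hL⟩ : Params) 0 => (⟨b.src.shift lam, b.dir⟩ : PBond (⟨d + 1, L, m, K, hd, hL⟩ : Params) 0))) - LinearMap.id) : BondSpace (⟨d + 1, L, m, K, hd, hL⟩ : Params) →ₗ[ℝ] BondSpace (⟨d + 1, L, m, K, hd, hL⟩ : Params))) ∘ₗ (tsV1 hc Λ' w).G) J b₀) ^ 2 else 0) := by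
    intro b₀
    split_ifs with hb
    · rw [mul_pow]
      have hz2 : (ζ b₀.src) ^ 2 ≤ Z ^ 2 := by
        rw [← sq_abs (ζ b₀.src)]
        exact pow_le_pow_left₀ (abs_nonneg _) (hζ b₀.src) 2
      exact mul_le_mul_of_nonneg_right hz2 (sq_nonneg _)
    · have hz : ζ b₀.src = 0 := by
        by_contra hne
        exact hb (hsuppζ b₀.src hne)
      rw [hz, zero_mul]; ring_nf; rfl
  have h1 : ∑ b₀ : PBond (⟨d + 1, L, m, K, hd, hL⟩ : Params) 0, (ζ b₀.src * (((((L : ℝ) ^ j) • (onE (LinearMap.funLeft ℝ ℝ (fun b : PBond (⟨d + 1, L, m, K, hd, hL⟩ : Params) 0 => (⟨b.src.shift lam, b.dir⟩ : PBond (⟨d + 1, L, m, K, hd, hL⟩ : Params) 0))) - LinearMap.id) : BondSpace (⟨d + 1, L, m, K, hd, hL⟩ : Params) →ₗ[ℝ] BondSpace (⟨d + 1, L, m, K, hd, hL⟩ : Params))) ∘ₗ (tsV1 hc Λ' w).G) J b₀) ^ 2 ≤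
      Z ^ 2 * ∑ b₀ ∈ univ.filter (fun b₀ : PBond (⟨d + 1, L, m, K, hd, hL⟩ : Params) 0 =>
        torusSupNorm (Mk (⟨d + 1, L, m, K, hd, hL⟩ : Params) j) (rep (Mk (⟨d + 1, L, m, K, hd, hL⟩ : Params) j) (iterBlockOf j b₀.src) - rep (Mk (⟨d + 1, L, m, K, hd, hL⟩ : Params) j) y) ≤ r), ((((((L : ℝ) ^ j) • (onE (LinearMap.funLeft ℝ ℝ (fun b : PBond (⟨d + 1, L, m, K, hd, hL⟩ : Params) 0 => (⟨b.src.shift lam, b.dir⟩ : PBond (⟨d + 1, L, m, K, hd, hL⟩ : Params) 0))) - LinearMap.id) : BondSpace (⟨d + 1, L, m, K, hd, hL⟩ : Params) →ₗ[ℝ] BondSpace (⟨d + 1, L, m, K, hd, hL⟩ : Params))) ∘ₗ (tsV1 hc Λ' w).G) J b₀) ^ 2 := by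
    refine (Finset.sum_le_sum fun b₀ _ => hζ2 b₀).trans (le_of_eq ?_)
    rw [Finset.sum_ite, Finset.sum_const_zero, add_zero, Finset.mul_sum]
  have hJ2 : ∑ b₀ : PBond (⟨d + 1, L, m, K, hd, hL⟩ : Params) 0, (J b₀) ^ 2 = ‖J‖ ^ 2 := (normSq_eq J).symm
  rw [hJ2] at hS
  have hconv : ∑ b₀ : PBond (⟨d + 1, L, m, K, hd, hL⟩ : Params) 0, (ζ b₀.src * (((L : ℝ) ^ j) * ((tsV1 hc Λ' w).G J ⟨b₀.src.shift lam, b₀.dir⟩ - (tsV1 hc Λ' w).G J b₀))) ^ 2 = ∑ b₀ : PBond (⟨d + 1, L, m, K, hd, hL⟩ : Params) 0, (ζ b₀.src * (((((L : ℝ) ^ j) • (onE (LinearMap.funLeft ℝ ℝ (fun b : PBond (⟨d + 1, L, m, K, hd, hL⟩ : Params) 0 => (⟨b.src.shift lam, b.dir⟩ : PBond (⟨d + 1, L, m, K, hd, hL⟩ : Params) 0))) - LinearMap.id) : BondSpace (⟨d + 1, L, m, K, hd, hL⟩ : Params) →ₗ[ℝ] BondSpace (⟨d + 1, L, m, K,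 hd, hL⟩ : Params))) ∘ₗ (tsV1 hc Λ' w).G) J b₀) ^ 2 :=
    Finset.sum_congr rfl fun b₀ _ => by rw [Dop_comp_apply]
  rw [hconv]
  refine h1.trans ((mul_le_mul_of_nonneg_left hS (sq_nonneg Z)).trans (le_of_eq ?_))
  have h2 : Real.exp (-(2 * min δa δb * torusSupNorm (Mk (⟨d + 1, L, m, K, hd, hL⟩ : Params) j) (rep (Mk (⟨d + 1, L, m, K, hd, hL⟩ : Params) j) y - rep (Mk (⟨d + 1, L, m, K, hd, hL⟩ : Params) j) y'))) =
      Real.exp (-(min δa δb * torusSupNorm (Mk (⟨d + 1, L, m, K, hd, hL⟩ : Params) j) (rep (Mk (⟨d + 1, L, m, K, hd, hL⟩ : Params) j) y - rep (Mk (⟨d + 1, L, m, K, hd, hL⟩ : Params) j) y'))) ^ 2 := by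
    rw [sq, ← Real.exp_add]; ring_nf
  rw [h2]; ring

/-! ## §2  `‖ζG∇*J‖`: the member of (1.114) with the divergence on the right -/

open Classical in
/-- **PROPOSITION 2.5, THE MEMBER `‖ζG∇*J‖` OF (1.114)** for the genuine two-scale `G` of (2.90), `Λ′` arbitrary (at `c = L^j`, weights in the
window), component `λ` of the divergence: `Σ_{b₀} (ζ(b₀₋)·(G(∇_λ*J))(b₀))² ≤ (C·e^{(1+2δ₂)r}·e^{−δ₂|y − y′|_T}·Z)²·‖J‖²`, `(∇_λ*J)(b) = n(J(b − e_λ) − J(b))`,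
for `J` supported over the unit sites within `r` of `y′` and `ζ` over those within `r` of `y`, `|ζ| ≤ Z` — the block Schur test with the row block
bound of `G∇_λ*` (file 14) and its column block bound = the row block bound of `(G∇_λ*)* = ∇_λG` (file 10).
[cite: Balaban1984PropagatorsII, Prop. 2.5 p.246; Balaban1984PropagatorsI, (1.114) p.36] -/
theorem prop25_ineq114_Gdiv (d L : ℕ) (hd : 1 ≤ d + 1) (hL : Odd L ∧ 1 < L) {a₀ a₁ : ℝ} (ha₀ : 0 < a₀) (ha₁ : a₀ ≤ a₁) :
    ∃ δ : ℝ, 0 < δ ∧ ∃ C : ℝ, 0 ≤ C ∧ ∀ (m K : ℕ) (j : ℕ) (hc : ((L : ℝ) ^ j) ≠ 0)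
      (_hj : j + 1 ≤ (⟨d + 1, L, m, K, hd, hL⟩ : Params).m + (⟨d + 1, L, m, K, hd, hL⟩ : Params).K)
      (Λ' : Finset (Site (⟨d + 1, L, m, K, hd, hL⟩ : Params) (j + 1))) (w : CIdx j Λ' → ℝ)
      (_hw0 : ∀ i, a₀ * ((L : ℝ) ^ j) ^ (d + 1) ≤ w i) (_hw1 : ∀ i, w i ≤ a₁ * ((L : ℝ) ^ j) ^ (d + 1)) (lam : Fin (d + 1))
      (r : ℝ) (_hr : 0 ≤ r) (J : BondSpace (⟨d + 1, L, m, K, hd, hL⟩ : Params))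
      (ζ : Site (⟨d + 1, L, m, K, hd, hL⟩ : Params) 0 → ℝ) (Z : ℝ) (_hZ : 0 ≤ Z)
      (y y' : Site (⟨d + 1, L, m, K, hd, hL⟩ : Params) j)
      (_hsuppJ : ∀ b : PBond (⟨d + 1, L, m, K, hd, hL⟩ : Params) 0, J b ≠ 0 →
        torusSupNorm (Mk (⟨d + 1, L, m, K, hd, hL⟩ : Params) j) (rep (Mk (⟨d + 1, L, m, K, hd, hL⟩ : Params) j) (iterBlockOf j b.src) - rep (Mk (⟨d + 1, L, m, K, hd, hL⟩ : Params) j) y') ≤ r)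
      (_hsuppζ : ∀ x : Site (⟨d + 1, L, m, K, hd, hL⟩ : Params) 0, ζ x ≠ 0 →
        torusSupNorm (Mk (⟨d + 1, L, m, K, hd, hL⟩ : Params) j) (rep (Mk (⟨d + 1, L, m, K, hd, hL⟩ : Params) j) (iterBlockOf j x) - rep (Mk (⟨d + 1, L, m, K, hd, hL⟩ : Params) j) y) ≤ r)
      (_hζ : ∀ x : Site (⟨d + 1, L, m, K, hd, hL⟩ : Params) 0, |ζ x| ≤ Z),
      ∑ b₀ : PBond (⟨d + 1, L, m, K, hd, hL⟩ : Params) 0, (ζ b₀.src * (tsV1 hc Λ' w).G (((((L : ℝ) ^ j) • (onE (LinearMap.funLeft ℝ ℝ (fun b : PBond (⟨d + 1, L, m, K, hd, hL⟩ : Params) 0 => (⟨b.src.unshift lam, b.dir⟩ : PBond (⟨d + 1, L, m, K, hd, hL⟩ : Params) 0))) - LinearMap.id) : BondSpace (⟨d + 1, L, m, K, hd, hL⟩ : Params) →ₗ[ℝ] BondSpace (⟨d + 1, L, m, K, hd, hL⟩ : Params))) J) b₀) ^ 2 ≤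
        (C * Real.exp ((1 + 2 * δ) * r) * Real.exp (-(δ * torusSupNorm (Mk (⟨d + 1, L, m, K, hd, hL⟩ : Params) j)
          (rep (Mk (⟨d + 1, L, m, K, hd, hL⟩ : Params) j) y - rep (Mk (⟨d + 1, L, m, K, hd, hL⟩ : Params) j) y'))) * Z) ^ 2 * ‖J‖ ^ 2 := by
  obtain ⟨δa, hδa, Ca, hCa, hrow⟩ := blockBound_GDadj_scaling d L hd hL ha₀ ha₁
  obtain ⟨δb, hδb, Cb, hCb, hcol⟩ := blockBound_DG_scaling d L hd hL ha₀ ha₁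
  have hδ0 : 0 < min δa δb := lt_min hδa hδb
  have hC : 0 ≤ max Ca Cb := le_max_of_le_left hCa
  refine ⟨min δa δb, hδ0, max Ca Cb * latticeConst (d + 1) 1, mul_nonneg hC (latticeConst_nonneg _ zero_le_one), ?_⟩
  intro m K j hc hj Λ' w hw0 hw1 lam r hr J ζ Z hZ y y' hsuppJ hsuppζ hζ
  have hL0 : 0 < L := by have := hL.2; omega
  have hLp : (0 : ℝ) < L := by exact_mod_cast hL0
  have hw : ∀ i, 0 < w i := fun i => lt_of_lt_of_le (by positivity) (hw0 i)
  have hρ : IsPseudoDist (fun t t' : Site (⟨d + 1, L, m, K, hd, hL⟩ : Params) j => torusSupNorm (Mk (⟨d + 1, L, m, K, hd, hL⟩ : Params) j) (rep (Mk (⟨d + 1, L, m, K, hd, hL⟩ : Params) j) t - rep (Mk (⟨d + 1, L, m, K, hd, hL⟩ : Params) j) t')) :=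
    torusDist_isPseudoDist (Mk (⟨d + 1, L, m, K, hd, hL⟩ : Params) j)
  have hK : SumBound (fun t t' : Site (⟨d + 1, L, m, K, hd, hL⟩ : Params) j => torusSupNorm (Mk (⟨d + 1, L, m, K, hd, hL⟩ : Params) j) (rep (Mk (⟨d + 1, L, m, K, hd, hL⟩ : Params) j) t - rep (Mk (⟨d + 1, L, m, K, hd, hL⟩ : Params) j) t')) (fun a => latticeConst (d + 1) a) :=
    torusDist_sumBound (Mk (⟨d + 1, L, m, K, hd, hL⟩ : Params) j)
  have hadj : LinearMap.adjoint ((tsV1 hc Λ' w).G ∘ₗ ((((L : ℝ) ^ j) • (onE (LinearMap.funLeft ℝ ℝ (fun b : PBond (⟨d + 1, L, m, K, hd, hL⟩ : Params) 0 => (⟨b.src.unshift lam, b.dir⟩ : PBond (⟨d + 1, L, m, K, hd, hL⟩ : Params) 0))) - LinearMap.id) : BondSpace (⟨d + 1, L, m, K, hd, hL⟩ : Params) →ₗ[ℝ] BondSpace (⟨d + 1, L, m, K, hd, hL⟩ : Params)))) = ((((L : ℝ) ^ j) • (onE (LinearMap.funLeft ℝ ℝ (fun b : PBond (⟨d + 1,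 L, m, K, hd, hL⟩ : Params) 0 => (⟨b.src.shift lam, b.dir⟩ : PBond (⟨d + 1, L, m, K, hd, hL⟩ : Params) 0))) - LinearMap.id) : BondSpace (⟨d + 1, L, m, K, hd, hL⟩ : Params) →ₗ[ℝ] BondSpace (⟨d + 1, L, m, K, hd, hL⟩ : Params))) ∘ₗ (tsV1 hc Λ' w).G := by
    rw [← adjoint_Dop, LinearMap.adjoint_comp (tsV1 hc Λ' w).G (LinearMap.adjoint ((((L : ℝ) ^ j) • (onE (LinearMap.funLeft ℝ ℝ (fun b : PBond (⟨d + 1, L, m, K, hd, hL⟩ : Params) 0 => (⟨b.src.shift lam, b.dir⟩ : PBond (⟨d + 1, L, m, K, hd, hL⟩ : Params) 0))) - LinearMap.id) : BondSpace (⟨d + 1, L, m, K, hd, hL⟩ : Params) →ₗ[ℝ] BondSpace (⟨d + 1, L, m, K, hd, hL⟩ : Params)))), LinearMap.adjoint_adjoint, adjoint_G_V1 hc hj Λ' hw]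
  have hf := blockBound_mono hρ ((tsV1 hc Λ' w).G ∘ₗ ((((L : ℝ) ^ j) • (onE (LinearMap.funLeft ℝ ℝ (fun b : PBond (⟨d + 1, L, m, K, hd, hL⟩ : Params) 0 => (⟨b.src.unshift lam, b.dir⟩ : PBond (⟨d + 1, L, m, K, hd, hL⟩ : Params) 0))) - LinearMap.id) : BondSpace (⟨d + 1, L, m, K, hd, hL⟩ : Params) →ₗ[ℝ] BondSpace (⟨d + 1, L, m, K, hd, hL⟩ : Params)))) (fun b₀ : PBond (⟨d + 1, L, m, K, hd, hL⟩ : Params) 0 => iterBlockOf j b₀.src) (fun b₀ : PBond (⟨d + 1, L, m, K, hd, hL⟩ : Params) 0 => iterBlockOf j b₀.src) hC (le_max_left Ca Cb) (min_le_left δa δb) (hrow m K j hc hj Λ' w hw0 hw1 lam)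
  have hg : ∀ (k : PBond (⟨d + 1, L, m, K, hd, hL⟩ : Params) 0) (y : Site (⟨d + 1, L, m, K, hd, hL⟩ : Params) j),
      ∑ i ∈ univ.filter (fun i : PBond (⟨d + 1, L, m, K, hd, hL⟩ : Params) 0 => iterBlockOf j i.src = y),
          |LinearMap.adjoint ((tsV1 hc Λ' w).G ∘ₗ ((((L : ℝ) ^ j) • (onE (LinearMap.funLeft ℝ ℝ (fun b : PBond (⟨d + 1, L, m, K, hd, hL⟩ : Params) 0 => (⟨b.src.unshift lam, b.dir⟩ : PBond (⟨d + 1, L, m, K, hd, hL⟩ : Params) 0))) - LinearMap.id) : BondSpace (⟨d + 1, L, m, K, hd, hL⟩ : Params) →ₗ[ℝ] BondSpace (⟨d + 1, L, m, K, hd, hL⟩ : Params)))) (EuclideanSpace.single i (1 : ℝ)) k| ≤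
        max Ca Cb * Real.exp (-(min δa δb * torusSupNorm (Mk (⟨d + 1, L, m, K, hd, hL⟩ : Params) j) (rep (Mk (⟨d + 1, L, m, K, hd, hL⟩ : Params) j) (iterBlockOf j k.src) - rep (Mk (⟨d + 1, L, m, K, hd, hL⟩ : Params) j) y))) := by
    rw [hadj]
    exact blockBound_mono hρ _ (fun b₀ : PBond (⟨d + 1, L, m, K, hd, hL⟩ : Params) 0 => iterBlockOf j b₀.src) (fun b₀ : PBond (⟨d + 1, L, m, K, hd, hL⟩ : Params) 0 => iterBlockOf j b₀.src) hC (le_max_right Ca Cb) (min_le_right δa δb) (hcol m K j hc hj Λ' w hw0 hw1 lam)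
  have hS := sum_sq_apply_le_of_blockBounds hρ hK ((tsV1 hc Λ' w).G ∘ₗ ((((L : ℝ) ^ j) • (onE (LinearMap.funLeft ℝ ℝ (fun b : PBond (⟨d + 1, L, m, K, hd, hL⟩ : Params) 0 => (⟨b.src.unshift lam, b.dir⟩ : PBond (⟨d + 1, L, m, K, hd, hL⟩ : Params) 0))) - LinearMap.id) : BondSpace (⟨d + 1, L, m, K, hd, hL⟩ : Params) →ₗ[ℝ] BondSpace (⟨d + 1, L, m, K, hd, hL⟩ : Params)))) (fun b₀ : PBond (⟨d + 1, L, m, K, hd, hL⟩ : Params) 0 => iterBlockOf j b₀.src) (fun b₀ : PBond (⟨d + 1, L, m, K, hd, hL⟩ : Params) 0 => iterBlockOf j b₀.src) hC hC hδ0.le hf hg J y y' hsuppJ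
  -- `ζ` vanishes off the ball of `y` and is bounded by `Z` on it
  have hζ2 : ∀ b₀ : PBond (⟨d + 1, L, m, K, hd, hL⟩ : Params) 0, (ζ b₀.src * ((tsV1 hc Λ' w).G ∘ₗ ((((L : ℝ) ^ j) • (onE (LinearMap.funLeft ℝ ℝ (fun b : PBond (⟨d + 1, L, m, K, hd, hL⟩ : Params) 0 => (⟨b.src.unshift lam, b.dir⟩ : PBond (⟨d + 1, L, m, K, hd, hL⟩ : Params) 0))) - LinearMap.id) : BondSpace (⟨d + 1, L, m, K, hd, hL⟩ : Params) →ₗ[ℝ] BondSpace (⟨d + 1, L, m, K, hd, hL⟩ : Params)))) J b₀) ^ 2 ≤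
      (if torusSupNorm (Mk (⟨d + 1, L, m, K, hd, hL⟩ : Params) j) (rep (Mk (⟨d + 1, L, m, K, hd, hL⟩ : Params) j) (iterBlockOf j b₀.src) - rep (Mk (⟨d + 1, L, m, K, hd, hL⟩ : Params) j) y) ≤ r
        then Z ^ 2 * (((tsV1 hc Λ' w).G ∘ₗ ((((L : ℝ) ^ j) • (onE (LinearMap.funLeft ℝ ℝ (fun b : PBond (⟨d + 1, L, m, K, hd, hL⟩ : Params) 0 => (⟨b.src.unshift lam, b.dir⟩ : PBond (⟨d + 1, L, m, K, hd, hL⟩ : Params) 0))) - LinearMap.id) : BondSpace (⟨d + 1, L, m, K, hd, hL⟩ : Params) →ₗ[ℝ] BondSpace (⟨d + 1, L, m, K, hd, hL⟩ : Params)))) J b₀) ^ 2 else 0) := by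
    intro b₀
    split_ifs with hb
    · rw [mul_pow]
      have hz2 : (ζ b₀.src) ^ 2 ≤ Z ^ 2 := by
        rw [← sq_abs (ζ b₀.src)]
        exact pow_le_pow_left₀ (abs_nonneg _) (hζ b₀.src) 2
      exact mul_le_mul_of_nonneg_right hz2 (sq_nonneg _)
    · have hz : ζ b₀.src = 0 := by
        by_contra hne
        exact hb (hsuppζ b₀.src hne)
      rw [hz, zero_mul]; ring_nf; rfl
  have h1 : ∑ b₀ : PBond (⟨d + 1, L, m, K, hd, hL⟩ : Params) 0, (ζ b₀.src * ((tsV1 hc Λ' w).G ∘ₗ ((((L : ℝ) ^ j) • (onE (LinearMap.funLeft ℝ ℝ (fun b : PBond (⟨d + 1, L, m, K, hd, hL⟩ : Params) 0 => (⟨b.src.unshift lam, b.dir⟩ : PBond (⟨d + 1, L, m, K, hd, hL⟩ : Params) 0))) - LinearMap.id) : BondSpace (⟨d + 1, L, m, K, hd, hL⟩ : Params) →ₗ[ℝ] BondSpace (⟨d + 1, L, m, K, hd, hL⟩ : Params)))) J b₀) ^ 2 ≤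
      Z ^ 2 * ∑ b₀ ∈ univ.filter (fun b₀ : PBond (⟨d + 1, L, m, K, hd, hL⟩ : Params) 0 =>
        torusSupNorm (Mk (⟨d + 1, L, m, K, hd, hL⟩ : Params) j) (rep (Mk (⟨d + 1, L, m, K, hd, hL⟩ : Params) j) (iterBlockOf j b₀.src) - rep (Mk (⟨d + 1, L, m, K, hd, hL⟩ : Params) j) y) ≤ r), (((tsV1 hc Λ' w).G ∘ₗ ((((L : ℝ) ^ j) • (onE (LinearMap.funLeft ℝ ℝ (fun b : PBond (⟨d + 1, L, m, K, hd, hL⟩ : Params) 0 => (⟨b.src.unshift lam, b.dir⟩ : PBond (⟨d + 1, L, m, K, hd, hL⟩ : Params) 0))) - LinearMap.id) : BondSpace (⟨d + 1, L, m, K, hd, hL⟩ : Params) →ₗ[ℝ] BondSpace (⟨d + 1, L, m, K, hd, hL⟩ : Params)))) J b₀) ^ 2 := by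
    refine (Finset.sum_le_sum fun b₀ _ => hζ2 b₀).trans (le_of_eq ?_)
    rw [Finset.sum_ite, Finset.sum_const_zero, add_zero, Finset.mul_sum]
  have hJ2 : ∑ b₀ : PBond (⟨d + 1, L, m, K, hd, hL⟩ : Params) 0, (J b₀) ^ 2 = ‖J‖ ^ 2 := (normSq_eq J).symm
  rw [hJ2] at hS
  have hconv : ∑ b₀ : PBond (⟨d + 1, L, m, K, hd, hL⟩ : Params) 0, (ζ b₀.src * (tsV1 hc Λ' w).G (((((L : ℝ) ^ j) • (onE (LinearMap.funLeft ℝ ℝ (fun b : PBond (⟨d + 1, L, m, K, hd, hL⟩ : Params) 0 => (⟨b.src.unshift lam, b.dir⟩ : PBond (⟨d + 1, L, m, K, hd, hL⟩ : Params) 0))) - LinearMap.id) : BondSpace (⟨d + 1, L, m, K, hd, hL⟩ : Params) →ₗ[ℝ] BondSpace (⟨d + 1, L, m, K, hd, hL⟩ : Params))) J) b₀) ^ 2 = ∑ b₀ : PBond (⟨d + 1, L, m, K, hd, hL⟩ : Params) 0, (ζ b₀.src * ((tsV1 hc Λ' w).G ∘ₗ ((((L : ℝ) ^ j) • (onE (LinearMap.funLeft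 ℝ ℝ (fun b : PBond (⟨d + 1, L, m, K, hd, hL⟩ : Params) 0 => (⟨b.src.unshift lam, b.dir⟩ : PBond (⟨d + 1, L, m, K, hd, hL⟩ : Params) 0))) - LinearMap.id) : BondSpace (⟨d + 1, L, m, K, hd, hL⟩ : Params) →ₗ[ℝ] BondSpace (⟨d + 1, L, m, K, hd, hL⟩ : Params)))) J b₀) ^ 2 :=
    Finset.sum_congr rfl fun b₀ _ => by rw [LinearMap.comp_apply]
  rw [hconv]
  refine h1.trans ((mul_le_mul_of_nonneg_left hS (sq_nonneg Z)).trans (le_of_eq ?_))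
  have h2 : Real.exp (-(2 * min δa δb * torusSupNorm (Mk (⟨d + 1, L, m, K, hd, hL⟩ : Params) j) (rep (Mk (⟨d + 1, L, m, K, hd, hL⟩ : Params) j) y - rep (Mk (⟨d + 1, L, m, K, hd, hL⟩ : Params) j) y'))) =
      Real.exp (-(min δa δb * torusSupNorm (Mk (⟨d + 1, L, m, K, hd, hL⟩ : Params) j) (rep (Mk (⟨d + 1, L, m, K, hd, hL⟩ : Params) j) y - rep (Mk (⟨d + 1, L, m, K, hd, hL⟩ : Params) j) y'))) ^ 2 := by
    rw [sq, ← Real.exp_add]; ring_nf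
  rw [h2]; ring

end Literature.MathematicalPhysics.QuantumFieldTheory.Balaban1983to89.B6Prop25L2LocGradTwoScaleV1

end
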